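import Summits.SmoothPoincare4.SmoothPoincare4.Theorems.ConvexBisectionAcyclicBisectionExistsStabBlockMapTwist
import Summits.SmoothPoincare4.SmoothPoincare4.Theorems.ConvexBisectionAcyclicBisectionExistsStabilisationAngles
import HarnessLib

/-!
# N3 (`stub_STgeo`) ▸ N3-nat ▸ N3d-1: THE TWO BLOCK ATTACHING MAPS of the stabilised base data —
# clauses `qA_circle`, `qA_twist`, `qA_tube`, `qB_circle`, `qB_twist`, `qB_tube`, `qAB_disjoint`,
# `range_qA`, `range_qB` of `StabBaseData` from the two block curves
(wave 7, brick H6-5 of stub `stub_STgeo` = node N3 of NF4, line `modp-braid-orbits`, crux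
`ConvexBisection.AcyclicBisectionExists`, item stmt-SmoothPoincare4-10508; registered sub-goal
`helper_exists_blockMaps`; design file `work/design/N3_Stabilisation_Design.lean` (G5, wave 6), piece
N3d-1 `node_stabBaseData`, split G1e(ii) "the maps `qA qB` by N3c"; vocabulary `…StabilisationData.lean`
(H6-1), bookkeeping `…StabilisationAngles.lean` (H6-2), one block map `…StabBlockMapTwist.lean` (H6-4).)

Given the two block curves of the stabilised base — smooth embeddings `A` into the flat page of
direction `pageDir (n+4) 0` and `B` into that of direction `pageDir (n+4) 2` of `Base g` (here `g`
stands for the design's `g + 1`) — this file produces the two block 2-handle attaching maps `qA`, `qB`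
with ALL NINE block-map clauses of `StabBaseData g⁻ n c` VERBATIM (`exists_blockMaps`): attaching
circles `A`, `B`; page twistings `−1`; the once-twisted standard tube maps of globally smooth fibred
tubes (sign `s = true`); DISJOINT ranges (the two pages are disjoint, `pageDir (n+4) 0 ≠ pageDir (n+4) 2`,
so the compact curves have disjoint open neighbourhoods in the Hausdorff base); and ranges inside the
block part `modelRegion g n δ₀ ε₁ ∩ {w ∈ blockSector n}` of the model region (open by H6-2, containing
both curves since the block directions lie in the open block sector, H6-1).  So of piece N3d-1 exactly the
1-handle presentation `E` with its six clauses and the two curves `A`, `B` with their `emb/page/shadow/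
cross` clauses remain.

Everything is proved; no definitions, no named facts.  References: J. B. Etnyre, T. Fuller, IMRN 2006,
§2 [EtnyreFuller2006]; R. İ. Baykur, AGT 6 (2006), Lemma 1 [Baykur2006]; A. A. Kosinski, *Differential
Manifolds* (1993), VI §6 [Kosinski1993].
-/

noncomputable section

-- the prescribed namespace `Summit.<P>.<Sub>.…` duplicates `SmoothPoincare4` (P = Sub)
set_option linter.dupNamespace false

open scoped Manifold ContDiff Topology Real
open Set Function Metric

namespace Summit.SmoothPoincare4.SmoothPoincare4.Theorems.AcyclicBisectionExists.ModpBraidOrbits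

open Literature.Topology.FourManifolds Literature.Topology.FourManifolds.LefschetzBase
open Literature.Topology.FourManifolds.HandleAttachingMap
open Literature.Geometry.Symplectic Literature.GroupTheory.CombinatorialGroupTheory.SignedHurwitz

namespace StabBlockMap

variable {g : ℕ}

/-! ## §1 The two block pages are distinct; the block part of the model region -/

/-- **The block directions `0` and `2` differ**: `e^{−iπ/(n+4)} ≠ e^{−5iπ/(n+4)}` since
`2/(n+4) ∉ ℤ`. [folklore] -/
theorem pageDir_zero_ne_two (n : ℕ) : pageDir (n + 4) 0 ≠ pageDir (n + 4) 2 := by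
  intro h
  rw [pageDir, pageDir, Complex.exp_eq_exp_iff_exists_int] at h
  obtain ⟨m, hm⟩ := h
  have hN : (0 : ℝ) < ((n + 4 : ℕ) : ℝ) := by positivity
  have hN' : (0 : ℝ) < (n : ℝ) + 4 := by positivity
  set a : ℝ := -(2 * π * (((0 : ℕ) : ℝ) + 1 / 2) / ((n + 4 : ℕ) : ℝ)) with ha
  set b : ℝ := -(2 * π * (((2 : ℕ) : ℝ) + 1 / 2) / ((n + 4 : ℕ) : ℝ)) with hb
  have hre : a = b + m * (2 * π) := by
    have h2 := congrArg Complex.im hm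
    simpa using h2
  have key : (2 : ℝ) = m * ((n : ℝ) + 4) := by
    rw [ha, hb] at hre
    field_simp at hre
    push_cast at hre
    nlinarith [hre, Real.pi_pos, hN', mul_pos Real.pi_pos hN']
  -- `0 < m (n + 4) = 2 < n + 4` forces `0 < m < 1`
  have hm0 : (0 : ℝ) < m := by nlinarith
  have hm1 : (m : ℝ) < 1 := by nlinarith
  have h0 : (0 : ℤ) < m := by exact_mod_cast hm0
  have h1 : m < (1 : ℤ) := by exact_mod_cast hm1
  omega

/-- **The block part of the model region** `modelRegion g n δ₀ ε₁ ∩ {w ∈ blockSector n}` is open and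
contains every flat page whose direction is a block direction `pageDir (n+4) i`, `i < 4`. [folklore] -/
theorem isOpen_blockPart (g n : ℕ) (δ₀ ε₁ : ℝ) :
    IsOpen {p : Base g | p ∈ modelRegion g n δ₀ ε₁ ∧ w g p.1 ∈ blockSector n} :=
  (StabilisationData.isOpen_modelRegion g n δ₀ ε₁).inter
    ((StabilisationData.isOpen_blockSector n).preimage
      ((contDiff_w g).continuous.comp continuous_subtype_val))

/-- Points of a block page lie in the block part of the model region. [folklore] -/
theorem mem_blockPart_of_mem_page {n : ℕ} {δ₀ ε₁ : ℝ} (hδ₀ : 0 < δ₀) {i : ℕ} (hi : i < 4) {p : Base g}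
    (hp : p ∈ page g (pageDir (n + 4) i)) :
    p ∈ modelRegion g n δ₀ ε₁ ∧ w g p.1 ∈ blockSector n := by
  refine ⟨StabilisationData.mem_modelRegion_of_mem_page hδ₀ (norm_pageDir _ _)
    (StabilisationData.pageDir_mem_blockSector n hi) hp, ?_⟩
  have h := StabilisationData.pageDir_div_two_mem_blockSector n hi
  rw [← hp.2] at h
  exact h

/-! ## §2 The two block attaching maps -/

/-- **The two block attaching maps of the stabilised base data** (`exists_blockMaps`): for smooth
embeddings `A`, `B` of the circle into the flat pages of directions `pageDir (n+4) 0`, `pageDir (n+4) 2`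
of `Base g` and `0 < δ₀`, attaching maps `qA`, `qB` with the nine block-map clauses of `StabBaseData`
VERBATIM (read at `g` for the design's `g + 1`): circles, page twistings `−1`, once-twisted standard tube
maps of globally smooth fibred tubes, disjoint ranges, ranges in the block part of the model region.
[cite: EtnyreFuller2006, §2] -/
theorem exists_blockMaps (g n : ℕ) {δ₀ : ℝ} (ε₁ : ℝ) (hδ₀ : 0 < δ₀)
    {A B : sphere (0 : EuclideanSpace ℝ (Fin 2)) 1 → Base g}
    (hA : Manifold.IsSmoothEmbedding (𝓡 1) (𝓡∂ 4) ∞ A) (hApage : ∀ θ, A θ ∈ page g (pageDir (n + 4) 0))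
    (hB : Manifold.IsSmoothEmbedding (𝓡 1) (𝓡∂ 4) ∞ B) (hBpage : ∀ θ, B θ ∈ page g (pageDir (n + 4) 2)) :
    ∃ qA qB : HandleAttachingMap 3 2 (Base g),
      qA.attachingCircle = A ∧ pageTwisting g A qA.attachingFraming = -1 ∧
      (∃ (Φ : sphere (0 : EuclideanSpace ℝ (Fin 2)) 1 × EuclideanSpace ℝ (Fin 2) → Base g)
          (κ σ : ℝ) (s : Bool), 0 < κ ∧ σ ≠ 0 ∧
        ContMDiff ((𝓡 1).prod (𝓡 2)) (𝓡∂ 4) ∞ Φ ∧ InjOn Φ (univ ×ˢ Metric.ball 0 (2 * κ)) ∧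
        (∀ x, Φ (x, 0) = A x) ∧
        (∀ x v, ‖v‖ < 2 * κ → Φ (x, v) ∈ page g (pageDir (n + 4) 0 * Complex.exp ((σ * v 1 : ℝ) * Complex.I))) ∧
        (∀ (x : sphere (0 : EuclideanSpace ℝ (Fin 2)) 1) (v : EuclideanSpace ℝ (Fin 2)) (_ : ‖v‖ < 1)
          (y : ↥(handleTube 3 2)),
          (y.1.1 : EuclideanSpace ℝ (Fin 4)) =
            WithLp.toLp 2 ![Real.sqrt (1 - ‖v‖ ^ 2) * x.1 0, Real.sqrt (1 - ‖v‖ ^ 2) * x.1 1, v 0, v 1] →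
          qA.toFun y = Φ (x, κ • WithLp.toLp 2 ![x.1 0 * v 0 + (if s then 1 else -1) * x.1 1 * v 1,
            x.1 0 * v 1 - (if s then 1 else -1) * x.1 1 * v 0]))) ∧
      qB.attachingCircle = B ∧ pageTwisting g B qB.attachingFraming = -1 ∧
      (∃ (Φ : sphere (0 : EuclideanSpace ℝ (Fin 2)) 1 × EuclideanSpace ℝ (Fin 2) → Base g)
          (κ σ : ℝ) (s : Bool), 0 < κ ∧ σ ≠ 0 ∧
        ContMDiff ((𝓡 1).prod (𝓡 2)) (𝓡∂ 4) ∞ Φ ∧ InjOn Φ (univ ×ˢ Metric.ball 0 (2 * κ)) ∧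
        (∀ x, Φ (x, 0) = B x) ∧
        (∀ x v, ‖v‖ < 2 * κ → Φ (x, v) ∈ page g (pageDir (n + 4) 2 * Complex.exp ((σ * v 1 : ℝ) * Complex.I))) ∧
        (∀ (x : sphere (0 : EuclideanSpace ℝ (Fin 2)) 1) (v : EuclideanSpace ℝ (Fin 2)) (_ : ‖v‖ < 1)
          (y : ↥(handleTube 3 2)),
          (y.1.1 : EuclideanSpace ℝ (Fin 4)) =
            WithLp.toLp 2 ![Real.sqrt (1 - ‖v‖ ^ 2) * x.1 0, Real.sqrt (1 - ‖v‖ ^ 2) * x.1 1, v 0, v 1] →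
          qB.toFun y = Φ (x, κ • WithLp.toLp 2 ![x.1 0 * v 0 + (if s then 1 else -1) * x.1 1 * v 1,
            x.1 0 * v 1 - (if s then 1 else -1) * x.1 1 * v 0]))) ∧
      Disjoint (range qA.toFun) (range qB.toFun) ∧
      (∀ y, qA.toFun y ∈ modelRegion g n δ₀ ε₁ ∧ w g (qA.toFun y).1 ∈ blockSector n) ∧
      (∀ y, qB.toFun y ∈ modelRegion g n δ₀ ε₁ ∧ w g (qB.toFun y).1 ∈ blockSector n) := by
  -- the two compact curves have disjoint images, hence disjoint open neighbourhoods
  have hdis : Disjoint (range A) (range B) := by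
    rw [Set.disjoint_left]
    rintro _ ⟨θ, rfl⟩ ⟨θ', hθ'⟩
    exact Set.disjoint_left.1 (disjoint_page g (pageDir_zero_ne_two n)) (hApage θ) (hθ' ▸ hBpage θ')
  obtain ⟨UA, UB, hUA, hUB, hAU, hBU, hUU⟩ := SeparatedNhds.of_isCompact_isCompact
    (isCompact_range hA.isEmbedding.continuous) (isCompact_range hB.isEmbedding.continuous) hdis
  -- the block part of the model region
  set W : Set (Base g) := {p : Base g | p ∈ modelRegion g n δ₀ ε₁ ∧ w g p.1 ∈ blockSector n} with hW
  have hWo : IsOpen W := isOpen_blockPart g n δ₀ ε₁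
  have hAW : range A ⊆ UA ∩ W := by
    rintro _ ⟨θ, rfl⟩
    exact ⟨hAU ⟨θ, rfl⟩, mem_blockPart_of_mem_page hδ₀ (by norm_num) (hApage θ)⟩
  have hBW : range B ⊆ UB ∩ W := by
    rintro _ ⟨θ, rfl⟩
    exact ⟨hBU ⟨θ, rfl⟩, mem_blockPart_of_mem_page hδ₀ (by norm_num) (hBpage θ)⟩
  -- one block map per curve (H6-4)
  obtain ⟨qA, hrA, hcA, htA, hΦA⟩ := exists_blockMap (norm_pageDir _ _) hA hApage (hUA.inter hWo) hAW
  obtain ⟨qB, hrB, hcB, htB, hΦB⟩ := exists_blockMap (norm_pageDir _ _) hB hBpage (hUB.inter hWo) hBW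
  refine ⟨qA, qB, hcA, htA, hΦA, hcB, htB, hΦB, ?_, fun y => (hrA ⟨y, rfl⟩).2, fun y => (hrB ⟨y, rfl⟩).2⟩
  exact Set.disjoint_of_subset (hrA.trans inter_subset_left) (hrB.trans inter_subset_left) hUU

/-! ## §3 N3d-1 from its two geometric parts -/

/-- **Piece N3d-1 (`Nonempty (StabBaseData g n c)`) from its two remaining geometric parts**: the fibred
1-handle presentation `E` of `Base (g+1)` over `Base g` with its clauses (`range_q1`, `page_mem`,
`fibred`, `flat`, `model_pullback`, `shadow_embed`, `twisting_transport`) and the two block curves `A`,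
`B` with theirs (`emb`, `page`, `shadow`, `cross`) — the nine block-map clauses being supplied by
`exists_blockMaps` at genus `g + 1`.  Kernel-checks that the block maps of this file plug into the
structure VERBATIM. [cite: EtnyreFuller2006, §2] -/
theorem nonempty_stabBaseData_of {g n : ℕ} {c : Fin g ⊕ Fin g → ℤ}
    (q1 : Fin 2 → HandleAttachingMap 3 1 (Base g))
    (E : MultiAttachmentData q1 (𝓡∂ 4) (Base (g + 1)))
    (A : Metric.sphere (0 : EuclideanSpace ℝ (Fin 2)) 1 → Base (g + 1))
    (B : Metric.sphere (0 : EuclideanSpace ℝ (Fin 2)) 1 → Base (g + 1))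
    (δ₀ : ℝ)
    (hδ₀ : 0 < δ₀)
    (ε₁ : ℝ)
    (hε₁ : 0 < ε₁ ∧ ε₁ ≤ 1 / 2)
    (range_q1 : ∀ (i : Fin 2) (y : ↥(handleTube 3 1)),
    (q1 i).toFun y ∈ modelRegion g n δ₀ ε₁ ∧ 4 - ε₁ < ‖cx ((q1 i).toFun y).1‖ ^ 2)
    (page_mem : ∀ (d : ℂ), ‖d‖ = 1 → ∀ p ∈ page g d, p ∈ coresComplement q1)
    (fibred : ∀ a : ↥(coresComplement q1), (∀ i y, (q1 i).toFun y ≠ (a : Base g)) →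
    w (g + 1) (E.jA a).1 = w g (a : Base g).1)
    (flat : ∀ (d : ℂ), ‖d‖ = 1 → ∀ (a : ↥(coresComplement q1)), (∀ i y, (q1 i).toFun y ≠ (a : Base g)) →
    (a : Base g) ∈ page g d → E.jA a ∈ page (g + 1) d)
    (model_pullback : ∀ a : ↥(coresComplement q1), E.jA a ∈ modelRegion (g + 1) n δ₀ ε₁ →
    (a : Base g) ∈ modelRegion g n δ₀ ε₁)
    (shadow_embed : ∀ (d : ℂ) (hd : ‖d‖ = 1)
    (K : Metric.sphere (0 : EuclideanSpace ℝ (Fin 2)) 1 → Base g) (hK : Continuous K)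
      (hKd : ∀ θ, K θ ∈ page g d),
      ∃ hK' : Continuous fun θ => E.jA ⟨K θ, page_mem d hd (K θ) (hKd θ)⟩,
        shadow (g + 1) (fun θ => E.jA ⟨K θ, page_mem d hd (K θ) (hKd θ)⟩) hK' =
          embed g (shadow g K hK))
    (twisting_transport : ∀ (d : ℂ) (hd : ‖d‖ = 1)
    (K : Metric.sphere (0 : EuclideanSpace ℝ (Fin 2)) 1 → Base g) (ν : Metric.sphere (0 : EuclideanSpace ℝ (Fin 2)) 1 → EuclideanSpace ℝ (Fin 4)),
      Manifold.IsSmoothEmbedding (𝓡 1) (𝓡∂ 4) ∞ K → (hKd : ∀ θ, K θ ∈ page g d) →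
      (∀ θ i y, (q1 i).toFun y ≠ K θ) → IsKnotFraming K ν →
      pageTwisting (g + 1) (fun θ => E.jA ⟨K θ, page_mem d hd (K θ) (hKd θ)⟩)
          (fun θ => mfderiv (𝓡∂ 4) (𝓡∂ 4) E.jA ⟨K θ, page_mem d hd (K θ) (hKd θ)⟩ (ν θ)) =
        pageTwisting g K ν)
    (A_emb : Manifold.IsSmoothEmbedding (𝓡 1) (𝓡∂ 4) ∞ A)
    (A_page : ∀ θ, A θ ∈ page (g + 1) (pageDir (n + 4) 0))
    (A_shadow : shadow (g + 1) A A_emb.isEmbedding.continuous = newE g + embed g c)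
    (A_cross : ∃ (t₀ : ℝ) (u : EuclideanSpace ℝ (Fin 3)) (ε : ℝ), ‖u‖ = 1 ∧ 0 < ε ∧
    (∀ s ∈ Ioo (-ε) ε, ∃ b : ↥(beltPiece 3 1), (b.1.1 : EuclideanSpace ℝ (Fin 4)) = crossVec u s ∧
      A (circlePt (t₀ + s)) = E.jB 0 b) ∧
    (∀ (θ : Metric.sphere (0 : EuclideanSpace ℝ (Fin 2)) 1) (b : ↥(beltPiece 3 1)),
      lamSq 1 (b.1.1 : EuclideanSpace ℝ (Fin 4)) = 0 → A θ = E.jB 0 b → θ = circlePt t₀) ∧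
    (∀ (θ : Metric.sphere (0 : EuclideanSpace ℝ (Fin 2)) 1) (b : ↥(beltPiece 3 1)),
      lamSq 1 (b.1.1 : EuclideanSpace ℝ (Fin 4)) = 0 → A θ ≠ E.jB 1 b))
    (B_emb : Manifold.IsSmoothEmbedding (𝓡 1) (𝓡∂ 4) ∞ B)
    (B_page : ∀ θ, B θ ∈ page (g + 1) (pageDir (n + 4) 2))
    (B_shadow : shadow (g + 1) B B_emb.isEmbedding.continuous = newF g)
    (B_cross : ∃ (t₀ : ℝ) (u : EuclideanSpace ℝ (Fin 3)) (ε : ℝ), ‖u‖ = 1 ∧ 0 < ε ∧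
    (∀ s ∈ Ioo (-ε) ε, ∃ b : ↥(beltPiece 3 1), (b.1.1 : EuclideanSpace ℝ (Fin 4)) = crossVec u s ∧
      B (circlePt (t₀ + s)) = E.jB 1 b) ∧
    (∀ (θ : Metric.sphere (0 : EuclideanSpace ℝ (Fin 2)) 1) (b : ↥(beltPiece 3 1)),
      lamSq 1 (b.1.1 : EuclideanSpace ℝ (Fin 4)) = 0 → B θ = E.jB 1 b → θ = circlePt t₀) ∧
    (∀ (θ : Metric.sphere (0 : EuclideanSpace ℝ (Fin 2)) 1) (b : ↥(beltPiece 3 1)),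
      lamSq 1 (b.1.1 : EuclideanSpace ℝ (Fin 4)) = 0 → B θ ≠ E.jB 0 b)) :
    Nonempty (StabBaseData g n c) := by
  obtain ⟨qA, qB, hcA, htA, hΦA, hcB, htB, hΦB, hdis, hrA, hrB⟩ :=
    exists_blockMaps (g + 1) n ε₁ hδ₀ A_emb A_page B_emb B_page
  exact ⟨{
    q1 := q1, E := E, A := A, B := B, qA := qA, qB := qB, δ₀ := δ₀, hδ₀ := hδ₀, ε₁ := ε₁,
    hε₁ := hε₁, range_q1 := range_q1, page_mem := page_mem, fibred := fibred, flat := flat,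
    model_pullback := model_pullback, shadow_embed := shadow_embed,
    twisting_transport := twisting_transport, A_emb := A_emb, A_page := A_page, A_shadow := A_shadow,
    A_cross := A_cross, qA_circle := hcA, qA_twist := htA, qA_tube := hΦA, B_emb := B_emb,
    B_page := B_page, B_shadow := B_shadow, B_cross := B_cross, qB_circle := hcB, qB_twist := htB,
    qB_tube := hΦB, qAB_disjoint := hdis, range_qA := hrA, range_qB := hrB }⟩

end StabBlockMap

/-! ## Registered helper -/

/-- **Registered helper `helper_exists_blockMaps` (sub-goal of `stub_STgeo` ▸ N3-nat ▸ N3d-1 ▸ block maps,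
wave 7, lead c5): the two block 2-handle attaching maps of the stabilised base data from the two block
curves, with the nine block-map clauses of `StabBaseData` (circles, page twistings `−1`, once-twisted
standard tube maps, disjoint ranges, ranges in the block part of the model region).**
[cite: EtnyreFuller2006, §2] -/
theorem helper_exists_blockMaps : ∀ (g n : ℕ) (δ₀ ε₁ : ℝ), 0 < δ₀ → ∀ (A B : Metric.sphere (0 : EuclideanSpace ℝ (Fin 2)) 1 → Literature.Topology.FourManifolds.LefschetzBase.Base g), Manifold.IsSmoothEmbedding (𝓡 1) (𝓡∂ 4) ∞ A → (∀ θ, A θ ∈ Literature.Topology.FourManifolds.LefschetzBase.page g (Literature.Topology.FourManifolds.LefschetzBase.pageDir (n + 4) 0)) → Manifold.IsSmoothEmbedding (𝓡 1) (𝓡∂ 4) ∞ B → (∀ θ, B θ ∈ Literature.Topology.FourManifolds.LefschetzBase.page g (Literature.Topology.FourManifolds.LefschetzBase.pageDir (n + 4) 2)) → ∃ qA qB : Literature.Topology.FourManifolds.HandleAttachingMap 3 2 (Literature.Topology.FourManifolds.LefschetzBase.Base g), qA.attachingCircle = A ∧ Literature.Topology.FourManifolds.LefschetzBase.pageTwisting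 g A qA.attachingFraming = -1 ∧ (∃ (Φ : Metric.sphere (0 : EuclideanSpace ℝ (Fin 2)) 1 × EuclideanSpace ℝ (Fin 2) → Literature.Topology.FourManifolds.LefschetzBase.Base g) (κ σ : ℝ) (s : Bool), 0 < κ ∧ σ ≠ 0 ∧ ContMDiff ((𝓡 1).prod (𝓡 2)) (𝓡∂ 4) ∞ Φ ∧ Set.InjOn Φ (Set.univ ×ˢ Metric.ball 0 (2 * κ)) ∧ (∀ x, Φ (x, 0) = A x) ∧ (∀ x v, ‖v‖ < 2 * κ → Φ (x, v) ∈ Literature.Topology.FourManifolds.LefschetzBase.page g (Literature.Topology.FourManifolds.LefschetzBase.pageDir (n + 4) 0 * Complex.exp ((σ * v 1 : ℝ) * Complex.I))) ∧ (∀ (x : Metric.sphere (0 : EuclideanSpace ℝ (Fin 2)) 1) (v : EuclideanSpace ℝ (Fin 2)) (_ : ‖v‖ < 1) (y : ↥(Literature.Topology.FourManifolds.handleTube 3 2)), (y.1.1 : EuclideanSpace ℝ (Fin 4)) = WithLp.toLp 2 ![Real.sqrt (1 - ‖v‖ ^ 2) * x.1 0, Real.sqrt (1 - ‖v‖ ^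 2) * x.1 1, v 0, v 1] → qA.toFun y = Φ (x, κ • WithLp.toLp 2 ![x.1 0 * v 0 + (if s then 1 else -1) * x.1 1 * v 1, x.1 0 * v 1 - (if s then 1 else -1) * x.1 1 * v 0]))) ∧ qB.attachingCircle = B ∧ Literature.Topology.FourManifolds.LefschetzBase.pageTwisting g B qB.attachingFraming = -1 ∧ (∃ (Φ : Metric.sphere (0 : EuclideanSpace ℝ (Fin 2)) 1 × EuclideanSpace ℝ (Fin 2) → Literature.Topology.FourManifolds.LefschetzBase.Base g) (κ σ : ℝ) (s : Bool), 0 < κ ∧ σ ≠ 0 ∧ ContMDiff ((𝓡 1).prod (𝓡 2)) (𝓡∂ 4) ∞ Φ ∧ Set.InjOn Φ (Set.univ ×ˢ Metric.ball 0 (2 * κ)) ∧ (∀ x, Φ (x, 0) = B x) ∧ (∀ x v, ‖v‖ < 2 * κ → Φ (x, v) ∈ Literature.Topology.FourManifolds.LefschetzBase.page g (Literature.Topology.FourManifolds.LefschetzBase.pageDir (n + 4) 2 * Complex.exp ((σ * v 1 : ℝ) * Complex.I))) ∧ (∀ (x : Metric.sphere (0 : EuclideanSpace ℝ (Fin 2))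 1) (v : EuclideanSpace ℝ (Fin 2)) (_ : ‖v‖ < 1) (y : ↥(Literature.Topology.FourManifolds.handleTube 3 2)), (y.1.1 : EuclideanSpace ℝ (Fin 4)) = WithLp.toLp 2 ![Real.sqrt (1 - ‖v‖ ^ 2) * x.1 0, Real.sqrt (1 - ‖v‖ ^ 2) * x.1 1, v 0, v 1] → qB.toFun y = Φ (x, κ • WithLp.toLp 2 ![x.1 0 * v 0 + (if s then 1 else -1) * x.1 1 * v 1, x.1 0 * v 1 - (if s then 1 else -1) * x.1 1 * v 0]))) ∧ Disjoint (Set.range qA.toFun) (Set.range qB.toFun) ∧ (∀ y, qA.toFun y ∈ Summit.SmoothPoincare4.SmoothPoincare4.Theorems.AcyclicBisectionExists.ModpBraidOrbits.modelRegion g n δ₀ ε₁ ∧ Literature.Topology.FourManifolds.LefschetzBase.w g (qA.toFun y).1 ∈ Summit.SmoothPoincare4.SmoothPoincare4.Theorems.AcyclicBisectionExists.ModpBraidOrbits.blockSector n) ∧ (∀ y, qB.toFun y ∈ Summit.SmoothPoincare4.SmoothPoincare4.Theorems.AcyclicBisectionExists.ModpBraidOrbits.modelRegion g n δ₀ ε₁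 ∧ Literature.Topology.FourManifolds.LefschetzBase.w g (qB.toFun y).1 ∈ Summit.SmoothPoincare4.SmoothPoincare4.Theorems.AcyclicBisectionExists.ModpBraidOrbits.blockSector n) :=
  fun g n _ ε₁ hδ₀ _ _ hA hApage hB hBpage => StabBlockMap.exists_blockMaps g n ε₁ hδ₀ hA hApage hB hBpage

end Summit.SmoothPoincare4.SmoothPoincare4.Theorems.AcyclicBisectionExists.ModpBraidOrbits

end
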